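import Mathlib.LinearAlgebra.Matrix.GeneralLinearGroup.Defs
import Mathlib.LinearAlgebra.Matrix.Nondegenerate
import Mathlib.LinearAlgebra.Matrix.ToLin
import Mathlib.LinearAlgebra.Matrix.ToLinearEquiv
import Mathlib.LinearAlgebra.Trace
import Mathlib.LinearAlgebra.FiniteDimensional.Lemmas
import Mathlib.LinearAlgebra.Matrix.Notation
import Mathlib.Tactic.FinCases
import HarnessLib

/-!
# Normal form of a non-regular semisimple skew-hermitian `3 × 3` matrix: an `h`-orthogonal eigenbasis at type `(a,a,b)`

Topic `Literature/LinearAlgebra/Matrix`; namespace `Literature.LinearAlgebra.Matrix`.  THEOREMS ONLY (no definition ∕ instance ∕ notation ∕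
named fact ∕ `sorry`); Mathlib-only imports; pure linear algebra over a field with involution (no topology, no measure).  Cell
`pub/hodgecm-mathlib`, crux H413 = `stmt-HodgeConjecture-24833` (lane `--supports`, count-neutral): brick **(ii-B) «NORMAL-FORM BASIS AT TYPE
(a,a,b)»** of the ROAD «HC-D» (holder F0P2-p01 (g23); D5(ii) holder F0P3a-p05 (g23); re-cut per the referee's R-758), seat LH10-p01 (g7),
2026-09-02.  Consumers: (ii-T) transport (F0P2-p06), (ii-E) normal-form `𝔠`-integral and the D5(ii) FINAL assembly (F0P3a-p05).
HONEST LABEL: HC_CM is proved only modulo the 7 printed citations (2 remaining: hLiu418 = `stmt-HodgeConjecture-24832`, h413 =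
`stmt-HodgeConjecture-24833`) until rung 0 closes; this file closes no organ.

## The statement (`exists_gl_conj_eq_diagonal_and_congr_diagonal`)

`K` a field with an involutive ring endomorphism `σ` and `2` invertible; `J ∈ M₃(K)` HERMITIAN (`(J^σ)ᵀ = J`) and invertible, defining
the sesquilinear form `h(v, w) = (σv)ᵀ J w`; `S₀ ∈ M₃(K)` SKEW (`(S₀^σ)ᵀ J + J S₀ = 0`, i.e. `h(S₀ v, w) = −h(v, S₀ w)`), killed by
`(X − a)(X − b)` with `a ≠ b`, and NOT SCALAR.  Then there is `g ∈ GL₃(K)` with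
  `g⁻¹ S₀ g = diag(a, a, b)` or `diag(b, b, a)` (always a `diag(x, x, y)`), and `(g^σ)ᵀ J g = diag(d₀, d₁, d₂)`, `σ dᵢ = dᵢ ≠ 0`
— the columns of `g` are an `h`-orthogonal eigenbasis of non-isotropic vectors.  By-product `sigma_eigenvalue_eq_neg`: `σ a = −a`, `σ b = −b`.

## The proof

`K³ = V_a ⊕ V_b` (`V_c = ker (S₀ − c)`, Bézout for `X − a`, `X − b`), both non-zero since `S₀` is not scalar.  Skewness gives
`(σc + c′) h(v, w) = 0` for eigenvectors `S₀ v = c v`, `S₀ w = c′ w`; non-degeneracy of `h` then forces `−σa ∈ {a, b}` and `−σb ∈ {a, b}`.  The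
swap `σa = −b`, `σb = −a` is impossible: the spectral projector `P_a = (a − b)⁻¹ (S₀ − b)` is a projection onto `V_a`, so
`trace S₀ = (a − b) r + 3b` with `r = dim V_a ∈ {1, 2}` (Mathlib `LinearMap.IsProj.trace`), while skewness gives `σ (trace S₀) = −trace S₀`;
under the swap this reads `(a − b)(2r − 3) = 0`.  Hence `σa = −a`, `σb = −b`, so `V_a ⊥_h V_b` and `h` is non-degenerate on each eigenspace.  A
non-degenerate hermitian plane∕line has a non-isotropic vector (if `h(v, v) ≡ 0`, polarisation gives a value `x ≠ 0` with `σx = −x` and then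
`2x² = 0`); Gram–Schmidt in the `2`-dimensional eigenspace (its dimension read off `dim V_a + dim V_b ≥ 3`, `dim V_c ≤ 2`) completes the
orthogonal eigenbasis; the matrix identities are read column by column.

## References
* [Scharlau1985HermitianForms] W. Scharlau, *Quadratic and Hermitian Forms* (1985), Ch. 7 (hermitian forms over rings with involution; orthogonal
  bases when `2` is a unit) — the frame; Ch. 1 §3 (Gram–Schmidt).
* [HornJohnson2013] R. A. Horn, C. R. Johnson, *Matrix Analysis* (2nd ed. 2013), §2.5 Thm. 2.5.3 (normal, e.g. skew-Hermitian, matrices are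
  unitarily diagonalisable) — the model statement over `ℂ`.
-/

set_option autoImplicit false

open Matrix

namespace Literature.LinearAlgebra.Matrix

section SkewHermitian

variable {K : Type*} [Field K] (σ : K →+* K)

/-! ### The sesquilinear form `h(v, w) = (σv)ᵀ J w` of a hermitian matrix `J` -/

/-- `h(v, w) = (σ ∘ v) ⬝ᵥ (J *ᵥ w)` is additive in `w`. [folklore] -/
private theorem hform_add_right (J : Matrix (Fin 3) (Fin 3) K) (v w w' : Fin 3 → K) :
    (σ ∘ v) ⬝ᵥ (J *ᵥ (w + w')) = (σ ∘ v) ⬝ᵥ (J *ᵥ w) + (σ ∘ v) ⬝ᵥ (J *ᵥ w') := by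
  rw [mulVec_add, dotProduct_add]

/-- `h(v, c w) = c h(v, w)`. [folklore] -/
private theorem hform_smul_right (J : Matrix (Fin 3) (Fin 3) K) (v w : Fin 3 → K) (c : K) :
    (σ ∘ v) ⬝ᵥ (J *ᵥ (c • w)) = c * ((σ ∘ v) ⬝ᵥ (J *ᵥ w)) := by
  rw [mulVec_smul, dotProduct_smul, smul_eq_mul]

/-- `h(v + v', w) = h(v, w) + h(v', w)`. [folklore] -/
private theorem hform_add_left (J : Matrix (Fin 3) (Fin 3) K) (v v' w : Fin 3 → K) :
    (σ ∘ (v + v')) ⬝ᵥ (J *ᵥ w) = (σ ∘ v) ⬝ᵥ (J *ᵥ w) + (σ ∘ v') ⬝ᵥ (J *ᵥ w) := by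
  have : (σ ∘ (v + v')) = σ ∘ v + σ ∘ v' := funext fun i => by simp
  rw [this, add_dotProduct]

/-- `h(c v, w) = σ(c) h(v, w)`. [folklore] -/
private theorem hform_smul_left (J : Matrix (Fin 3) (Fin 3) K) (v w : Fin 3 → K) (c : K) :
    (σ ∘ (c • v)) ⬝ᵥ (J *ᵥ w) = σ c * ((σ ∘ v) ⬝ᵥ (J *ᵥ w)) := by
  have : (σ ∘ (c • v)) = σ c • (σ ∘ v) := funext fun i => by simp
  rw [this, smul_dotProduct, smul_eq_mul]

/-- HERMITIAN SYMMETRY: `σ (h(v, w)) = h(w, v)` when `(J.map σ)ᵀ = J` and `σ` is an involution. [folklore] -/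
private theorem hform_herm (hσ : ∀ x, σ (σ x) = x) {J : Matrix (Fin 3) (Fin 3) K} (hJσ : (J.map σ)ᵀ = J) (v w : Fin 3 → K) :
    σ ((σ ∘ v) ⬝ᵥ (J *ᵥ w)) = (σ ∘ w) ⬝ᵥ (J *ᵥ v) := by
  have hJ' : ∀ i j, σ (J i j) = J j i := fun i j => by
    have := congrFun (congrFun hJσ j) i
    simpa [Matrix.transpose_apply, Matrix.map_apply] using this
  simp only [dotProduct, mulVec, Function.comp_apply, map_sum, map_mul, hσ, hJ', Finset.mul_sum]
  rw [Finset.sum_comm]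
  refine Finset.sum_congr rfl fun i _ => Finset.sum_congr rfl fun j _ => ?_
  ring

/-- SKEWNESS: `h(S v, w) = −h(v, S w)` for `S` with `(S.map σ)ᵀ J + J S = 0`. [folklore] -/
private theorem hform_skew {J S : Matrix (Fin 3) (Fin 3) K} (hS : (S.map σ)ᵀ * J + J * S = 0) (v w : Fin 3 → K) :
    (σ ∘ (S *ᵥ v)) ⬝ᵥ (J *ᵥ w) = -((σ ∘ v) ⬝ᵥ (J *ᵥ (S *ᵥ w))) := by
  have h1 : (σ ∘ (S *ᵥ v)) = (S.map σ) *ᵥ (σ ∘ v) := by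
    funext i
    simp [Function.comp_apply, mulVec, dotProduct, map_sum, map_mul, Matrix.map_apply]
  have h2 : (S.map σ)ᵀ * J = -(J * S) := eq_neg_of_add_eq_zero_left hS
  rw [h1, ← vecMul_transpose, ← dotProduct_mulVec, mulVec_mulVec, h2, neg_mulVec, dotProduct_neg, ← mulVec_mulVec]

/-- NON-DEGENERACY (left): if `h(v, w) = 0` for all `w` then `v = 0` (`J` invertible). [folklore] -/
private theorem hform_nondeg_left {J : Matrix (Fin 3) (Fin 3) K} (hJ : IsUnit J.det) {v : Fin 3 → K}
    (h : ∀ w, (σ ∘ v) ⬝ᵥ (J *ᵥ w) = 0) : v = 0 := by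
  have h1 : (σ ∘ v) ᵥ* J = 0 := by
    funext i
    have := h (Pi.single i 1)
    rwa [dotProduct_mulVec, dotProduct_single, mul_one] at this
  have h2 : (σ ∘ v) = 0 := eq_zero_of_vecMul_eq_zero hJ.ne_zero h1
  funext i
  have := congrFun h2 i
  simpa using this

/-- NON-DEGENERACY (right): if `h(v, w) = 0` for all `v` then `w = 0`. [folklore] -/
private theorem hform_nondeg_right {J : Matrix (Fin 3) (Fin 3) K} (hJ : IsUnit J.det) {w : Fin 3 → K}
    (h : ∀ v, (σ ∘ v) ⬝ᵥ (J *ᵥ w) = 0) : w = 0 := by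
  have h1 : J *ᵥ w = 0 := by
    funext i
    have := h (Pi.single i 1)
    have e : (σ ∘ (Pi.single i (1 : K) : Fin 3 → K)) = Pi.single i 1 := by
      funext j
      by_cases hj : j = i
      · subst hj; simp
      · simp [Pi.single_eq_of_ne hj]
    rwa [e, single_dotProduct, one_mul] at this
  exact eq_zero_of_mulVec_eq_zero hJ.ne_zero h1

/-! ### From three `h`-orthogonal non-isotropic eigenvectors to `g` -/

/-- **Matrix assembly.**  Three eigenvectors `c 0, c 1, c 2` of `S` (`S cⱼ = λⱼ cⱼ`), pairwise `h`-orthogonal and non-isotropic,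
are the columns of a `g ∈ GL₃(K)` with `g⁻¹ S g = diagonal λ` and `(g^σ)ᵀ J g = diagonal (h(cᵢ, cᵢ))`. [folklore] -/
private theorem exists_gl_of_orthogonal_eigenvectors {J S : Matrix (Fin 3) (Fin 3) K} (c : Fin 3 → Fin 3 → K) (lam : Fin 3 → K)
    (heig : ∀ j, S *ᵥ c j = lam j • c j) (horth : ∀ i j, i ≠ j → (σ ∘ c i) ⬝ᵥ (J *ᵥ c j) = 0)
    (hnis : ∀ i, (σ ∘ c i) ⬝ᵥ (J *ᵥ c i) ≠ 0) :
    ∃ g : GL (Fin 3) K, (g : Matrix (Fin 3) (Fin 3) K)⁻¹ * S * g = diagonal lam ∧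
      ((g : Matrix (Fin 3) (Fin 3) K).map σ)ᵀ * J * g = diagonal fun i => (σ ∘ c i) ⬝ᵥ (J *ᵥ c i) := by
  let g : Matrix (Fin 3) (Fin 3) K := Matrix.of fun i j => c j i
  have hgcol : ∀ x : Fin 3 → K, g *ᵥ x = ∑ j, x j • c j := fun x => by
    funext i
    simp only [g, mulVec, dotProduct, Matrix.of_apply, Finset.sum_apply, Pi.smul_apply, smul_eq_mul]
    exact Finset.sum_congr rfl fun j _ => mul_comm _ _
  -- `(g^σ)ᵀ J g` has entries `h(cᵢ, cⱼ)`
  have hgram : ∀ i j, (((g.map σ)ᵀ * J * g) i j) = (σ ∘ c i) ⬝ᵥ (J *ᵥ c j) := fun i j => by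
    simp only [Matrix.mul_apply, Matrix.transpose_apply, Matrix.map_apply, g, Matrix.of_apply, dotProduct, mulVec,
      Function.comp_apply, Finset.sum_mul]
    rw [Finset.sum_comm]
    simp only [Finset.mul_sum, mul_assoc]
  -- `g` is invertible: `g x = 0 ⇒ x = 0`
  have hdet : g.det ≠ 0 := by
    intro hdet
    obtain ⟨x, hx, hgx⟩ := Matrix.exists_mulVec_eq_zero_iff.2 hdet
    apply hx
    funext i
    have h0 : (σ ∘ c i) ⬝ᵥ (J *ᵥ (g *ᵥ x)) = 0 := by rw [hgx, mulVec_zero, dotProduct_zero]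
    rw [hgcol, mulVec_sum, dotProduct_sum] at h0
    have h1 : ∑ j, (σ ∘ c i) ⬝ᵥ (J *ᵥ (x j • c j)) = x i * ((σ ∘ c i) ⬝ᵥ (J *ᵥ c i)) := by
      rw [Finset.sum_eq_single i]
      · rw [hform_smul_right]
      · intro j _ hji
        rw [hform_smul_right, horth i j (Ne.symm hji), mul_zero]
      · intro hi; exact absurd (Finset.mem_univ i) hi
    rw [h1] at h0
    exact (mul_eq_zero.1 h0).resolve_right (hnis i)
  refine ⟨Matrix.GeneralLinearGroup.mkOfDetNeZero g hdet, ?_, ?_⟩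
  · change g⁻¹ * S * g = diagonal lam
    have hSg : S * g = g * diagonal lam := by
      ext i j
      have := congrFun (heig j) i
      simp only [mulVec, dotProduct, Pi.smul_apply, smul_eq_mul] at this
      rw [mul_diagonal, Matrix.mul_apply]
      simp only [g, Matrix.of_apply]
      rw [this, mul_comm]
    rw [Matrix.mul_assoc, hSg, ← Matrix.mul_assoc, Matrix.nonsing_inv_mul _ (isUnit_iff_ne_zero.2 hdet), Matrix.one_mul]
  · change (g.map σ)ᵀ * J * g = _
    ext i j
    rw [hgram, diagonal_apply]
    by_cases hij : i = j
    · subst hij; simp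
    · rw [if_neg hij, horth i j hij]

/-! ### The two eigenspaces of `S₀` with `(S₀ − a)(S₀ − b) = 0`, `a ≠ b` -/

/-- The two factors commute: `(S₀ − b)(S₀ − a) = (S₀ − a)(S₀ − b)`. [folklore] -/
private theorem factors_comm (S₀ : Matrix (Fin 3) (Fin 3) K) (a b : K) :
    (S₀ - b • (1 : Matrix (Fin 3) (Fin 3) K)) * (S₀ - a • 1) = (S₀ - a • 1) * (S₀ - b • 1) := by
  simp only [sub_mul, mul_sub, Matrix.smul_mul, Matrix.mul_smul, Matrix.one_mul, Matrix.mul_one, smul_smul, mul_comm b a]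
  abel

/-- `(S₀ − c • 1) v = 0 ↔ S₀ v = c • v`. [folklore] -/
private theorem sub_smul_one_mulVec_eq_zero_iff (S₀ : Matrix (Fin 3) (Fin 3) K) (c : K) (v : Fin 3 → K) :
    (S₀ - c • (1 : Matrix (Fin 3) (Fin 3) K)) *ᵥ v = 0 ↔ S₀ *ᵥ v = c • v := by
  rw [sub_mulVec, smul_mulVec, one_mulVec, sub_eq_zero]

/-- DECOMPOSITION `v = v_a + v_b` along the two eigenspaces: `v_a = (a − b)⁻¹ (S₀ − b) v ∈ V_a`, `v_b = (b − a)⁻¹ (S₀ − a) v ∈ V_b`. [folklore] -/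
private theorem eigen_decomp {S₀ : Matrix (Fin 3) (Fin 3) K} {a b : K} (hab : a ≠ b) (hmin : (S₀ - a • 1) * (S₀ - b • 1) = 0) (v : Fin 3 → K) :
    v = (a - b)⁻¹ • ((S₀ - b • 1) *ᵥ v) + (b - a)⁻¹ • ((S₀ - a • 1) *ᵥ v) ∧
      (S₀ - a • 1) *ᵥ ((a - b)⁻¹ • ((S₀ - b • 1) *ᵥ v)) = 0 ∧
      (S₀ - b • 1) *ᵥ ((b - a)⁻¹ • ((S₀ - a • 1) *ᵥ v)) = 0 := by
  have hab' : a - b ≠ 0 := sub_ne_zero.2 hab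
  refine ⟨?_, ?_, ?_⟩
  · have h1 : (S₀ - b • (1 : Matrix (Fin 3) (Fin 3) K)) *ᵥ v - (S₀ - a • 1) *ᵥ v = (a - b) • v := by
      rw [sub_mulVec, sub_mulVec, smul_mulVec, smul_mulVec, one_mulVec, sub_smul]; abel
    have h2 : (b - a)⁻¹ = -(a - b)⁻¹ := by rw [← neg_sub, neg_inv]
    rw [h2, neg_smul, ← sub_eq_add_neg, ← smul_sub, h1, smul_smul, inv_mul_cancel₀ hab', one_smul]
  · rw [mulVec_smul, mulVec_mulVec, hmin, zero_mulVec, smul_zero]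
  · rw [mulVec_smul, mulVec_mulVec, factors_comm, hmin, zero_mulVec, smul_zero]

/-- `h`-RELATION between eigenvectors of a skew `S₀`: `S₀ v = c v`, `S₀ w = c' w` ⇒ `(σc + c') h(v, w) = 0`. [folklore] -/
private theorem eigen_hform_rel {J S₀ : Matrix (Fin 3) (Fin 3) K} (hS : (S₀.map σ)ᵀ * J + J * S₀ = 0) {c c' : K} {v w : Fin 3 → K}
    (hv : S₀ *ᵥ v = c • v) (hw : S₀ *ᵥ w = c' • w) : (σ c + c') * ((σ ∘ v) ⬝ᵥ (J *ᵥ w)) = 0 := by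
  have h := hform_skew σ hS v w
  rw [hv, hw, hform_smul_left, hform_smul_right] at h
  rw [add_mul]
  exact add_eq_zero_iff_eq_neg.2 h

/-- Each eigenspace is NON-ZERO when `S₀` is not scalar: `∃ v ≠ 0, (S₀ − a) v = 0`. [folklore] -/
private theorem exists_eigenvector {S₀ : Matrix (Fin 3) (Fin 3) K} {a b : K} (hmin : (S₀ - a • 1) * (S₀ - b • 1) = 0)
    (hns : ∀ c : K, S₀ ≠ c • 1) : ∃ v : Fin 3 → K, v ≠ 0 ∧ (S₀ - a • 1) *ᵥ v = 0 := by
  -- `S₀ − b•1 ≠ 0`, so some column of it is a non-zero vector of `V_a`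
  have hB : S₀ - b • (1 : Matrix (Fin 3) (Fin 3) K) ≠ 0 := fun h => hns b (sub_eq_zero.1 h)
  obtain ⟨i, j, hij⟩ : ∃ i j, (S₀ - b • (1 : Matrix (Fin 3) (Fin 3) K)) i j ≠ 0 := by
    by_contra h
    push Not at h
    exact hB (Matrix.ext fun i j => by rw [h i j]; rfl)
  refine ⟨(S₀ - b • 1) *ᵥ Pi.single j 1, fun h0 => hij ?_, ?_⟩
  · have := congrFun h0 i
    rwa [mulVec_single_one] at this
  · rw [mulVec_mulVec, hmin, zero_mulVec]

/-- The eigenvalues of a skew `S₀` of type `{a, b}` satisfy `σ a ∈ {−a, −b}`. [folklore] -/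
private theorem sigma_eq_neg_or {J S₀ : Matrix (Fin 3) (Fin 3) K} (hJ : IsUnit J.det) (hS : (S₀.map σ)ᵀ * J + J * S₀ = 0) {a b : K} (hab : a ≠ b)
    (hmin : (S₀ - a • 1) * (S₀ - b • 1) = 0) (hns : ∀ c : K, S₀ ≠ c • 1) : σ a = -a ∨ σ a = -b := by
  obtain ⟨v, hv0, hv⟩ := exists_eigenvector hmin hns
  have hva : S₀ *ᵥ v = a • v := (sub_smul_one_mulVec_eq_zero_iff S₀ a v).1 hv
  -- some `w` pairs non-trivially with `v`
  obtain ⟨w, hw⟩ : ∃ w, (σ ∘ v) ⬝ᵥ (J *ᵥ w) ≠ 0 := by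
    by_contra h
    push Not at h
    exact hv0 (hform_nondeg_left σ hJ h)
  obtain ⟨hdec, hwa, hwb⟩ := eigen_decomp hab hmin w
  have hwa' := (sub_smul_one_mulVec_eq_zero_iff S₀ a _).1 hwa
  have hwb' := (sub_smul_one_mulVec_eq_zero_iff S₀ b _).1 hwb
  rw [hdec, hform_add_right] at hw
  by_cases h1 : (σ ∘ v) ⬝ᵥ (J *ᵥ ((a - b)⁻¹ • ((S₀ - b • 1) *ᵥ w))) = 0
  · rw [h1, zero_add] at hw
    have := eigen_hform_rel σ hS hva hwb'
    exact Or.inr (eq_neg_of_add_eq_zero_left ((mul_eq_zero.1 this).resolve_right hw))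
  · have := eigen_hform_rel σ hS hva hwa'
    exact Or.inl (eq_neg_of_add_eq_zero_left ((mul_eq_zero.1 this).resolve_right h1))

/-- ORTHOGONALITY `V_a ⊥_h V_b` once `σ a = −a`. [folklore] -/
private theorem hform_eq_zero_of_eigen {J S₀ : Matrix (Fin 3) (Fin 3) K} (hS : (S₀.map σ)ᵀ * J + J * S₀ = 0) {a b : K} (hab : a ≠ b)
    (hσa : σ a = -a) {v w : Fin 3 → K} (hv : S₀ *ᵥ v = a • v) (hw : S₀ *ᵥ w = b • w) : (σ ∘ v) ⬝ᵥ (J *ᵥ w) = 0 := by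
  have := eigen_hform_rel σ hS hv hw
  rw [hσa] at this
  exact (mul_eq_zero.1 this).resolve_left (fun h => hab (neg_add_eq_zero.1 h))

/-- `h` is NON-DEGENERATE ON `V_a` (given `V_a ⊥ V_b`): a non-zero `v ∈ V_a` pairs non-trivially with some `w ∈ V_a`. [folklore] -/
private theorem exists_hform_ne_zero_eigen {J S₀ : Matrix (Fin 3) (Fin 3) K} (hJ : IsUnit J.det) (hS : (S₀.map σ)ᵀ * J + J * S₀ = 0) {a b : K}
    (hab : a ≠ b) (hmin : (S₀ - a • 1) * (S₀ - b • 1) = 0) (hσa : σ a = -a) {v : Fin 3 → K} (hv0 : v ≠ 0) (hv : S₀ *ᵥ v = a • v) :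
    ∃ w, S₀ *ᵥ w = a • w ∧ (σ ∘ v) ⬝ᵥ (J *ᵥ w) ≠ 0 := by
  obtain ⟨w, hw⟩ : ∃ w, (σ ∘ v) ⬝ᵥ (J *ᵥ w) ≠ 0 := by
    by_contra h
    push Not at h
    exact hv0 (hform_nondeg_left σ hJ h)
  obtain ⟨hdec, hwa, hwb⟩ := eigen_decomp hab hmin w
  have hwa' := (sub_smul_one_mulVec_eq_zero_iff S₀ a _).1 hwa
  have hwb' := (sub_smul_one_mulVec_eq_zero_iff S₀ b _).1 hwb
  rw [hdec, hform_add_right, hform_eq_zero_of_eigen σ hS hab hσa hv hwb', add_zero] at hw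
  exact ⟨_, hwa', hw⟩

/-- A NON-ISOTROPIC EIGENVECTOR exists in `V_a` (`2` invertible): if `h(v, v) = 0` on all of `V_a`, polarisation gives `σx = −x` for some value
`x = h(v, w) ≠ 0`, and then `h(v, xw) + h(xw, v) = 2x² = 0`. [folklore] -/
private theorem exists_nonisotropic_eigenvector [Invertible (2 : K)] (hσ : ∀ x, σ (σ x) = x) {J S₀ : Matrix (Fin 3) (Fin 3) K} (hJσ : (J.map σ)ᵀ = J)
    (hJ : IsUnit J.det) (hS : (S₀.map σ)ᵀ * J + J * S₀ = 0) {a b : K} (hab : a ≠ b) (hmin : (S₀ - a • 1) * (S₀ - b • 1) = 0)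
    (hns : ∀ c : K, S₀ ≠ c • 1) (hσa : σ a = -a) :
    ∃ v : Fin 3 → K, S₀ *ᵥ v = a • v ∧ (σ ∘ v) ⬝ᵥ (J *ᵥ v) ≠ 0 := by
  by_contra hall
  push Not at hall
  obtain ⟨v, hv0, hv⟩ := exists_eigenvector hmin hns
  have hva : S₀ *ᵥ v = a • v := (sub_smul_one_mulVec_eq_zero_iff S₀ a v).1 hv
  obtain ⟨w, hwa, hx⟩ := exists_hform_ne_zero_eigen σ hJ hS hab hmin hσa hv0 hva
  set x := (σ ∘ v) ⬝ᵥ (J *ᵥ w) with hxdef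
  -- polarisation on `v + w`
  have hvw : S₀ *ᵥ (v + w) = a • (v + w) := by rw [mulVec_add, hva, hwa, smul_add]
  have hpol := hall (v + w) hvw
  rw [hform_add_left, hform_add_right, hform_add_right, hall v hva, hall w hwa, zero_add, add_zero] at hpol
  -- so `h(w, v) = −x` and `σ x = −x`
  have hwv : (σ ∘ w) ⬝ᵥ (J *ᵥ v) = -x := eq_neg_of_add_eq_zero_right hpol
  have hσx : σ x = -x := by rw [hxdef, hform_herm σ hσ hJσ, hwv]
  -- polarisation on `v + x • w`
  have hvxw : S₀ *ᵥ (v + x • w) = a • (v + x • w) := by rw [mulVec_add, mulVec_smul, hva, hwa, smul_add, smul_comm]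
  have hpol2 := hall (v + x • w) hvxw
  rw [hform_add_left, hform_add_right, hform_add_right, hall v hva, hform_smul_right, hform_smul_left, hform_smul_left,
    hform_smul_right, hall w hwa, hwv, hσx, zero_add, mul_zero, mul_zero, add_zero, ← hxdef] at hpol2
  -- `x * x + (-x) * (-x) = 0`
  have h2 : (2 : K) * (x * x) = 0 := by linear_combination hpol2
  have hxx : x * x = 0 := by
    have := congrArg (fun t => ⅟(2 : K) * t) h2
    simpa [← mul_assoc] using this
  exact hx (mul_self_eq_zero.1 hxx)

/-! ### `σ a = −a`, `σ b = −b`: the swap `σ a = −b` is excluded by the trace of the spectral projector -/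

/-- The spectral projector `P_a = (a − b)⁻¹ (S₀ − b)` is a projection onto `V_a = ker (S₀ − a)`; its trace is `dim V_a ∈ {1, 2}`:
`trace S₀ = (a − b) · dim V_a + 3b` with `dim V_a = 1` or `2`. [folklore] -/
private theorem trace_eq_of_typeAAB {S₀ : Matrix (Fin 3) (Fin 3) K} {a b : K} (hab : a ≠ b) (hmin : (S₀ - a • 1) * (S₀ - b • 1) = 0)
    (hns : ∀ c : K, S₀ ≠ c • 1) :
    ∃ r : ℕ, (r = 1 ∨ r = 2) ∧ S₀.trace = (a - b) * r + 3 * b := by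
  have hab' : a - b ≠ 0 := sub_ne_zero.2 hab
  set Va : Submodule K (Fin 3 → K) := LinearMap.ker (Matrix.toLin' (S₀ - a • (1 : Matrix (Fin 3) (Fin 3) K))) with hVa
  have hmemVa : ∀ v, v ∈ Va ↔ (S₀ - a • (1 : Matrix (Fin 3) (Fin 3) K)) *ᵥ v = 0 := fun v => by
    rw [hVa, LinearMap.mem_ker, Matrix.toLin'_apply]
  set P : Matrix (Fin 3) (Fin 3) K := (a - b)⁻¹ • (S₀ - b • 1) with hP
  have hproj : LinearMap.IsProj Va (Matrix.toLin' P) := by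
    constructor
    · intro x
      rw [hmemVa, Matrix.toLin'_apply, hP, smul_mulVec]
      exact (eigen_decomp hab hmin x).2.1
    · intro x hx
      rw [hmemVa] at hx
      rw [Matrix.toLin'_apply, hP, smul_mulVec]
      have h1 : (S₀ - b • (1 : Matrix (Fin 3) (Fin 3) K)) *ᵥ x = (S₀ - a • (1 : Matrix (Fin 3) (Fin 3) K)) *ᵥ x + (a - b) • x := by
        rw [sub_mulVec, sub_mulVec, smul_mulVec, smul_mulVec, one_mulVec, sub_smul]; abel
      rw [h1, hx, zero_add, smul_smul, inv_mul_cancel₀ hab', one_smul]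
  have htr : LinearMap.trace K _ (Matrix.toLin' P) = (Module.finrank K Va : K) := hproj.trace
  rw [Matrix.trace_toLin'_eq, hP, Matrix.trace_smul, Matrix.trace_sub, Matrix.trace_smul, Matrix.trace_one, Fintype.card_fin,
    smul_eq_mul, smul_eq_mul] at htr
  -- `1 ≤ dim V_a ≤ 2`
  obtain ⟨v, hv0, hv⟩ := exists_eigenvector hmin hns
  have hmin' : (S₀ - b • 1) * (S₀ - a • 1) = 0 := by rw [factors_comm]; exact hmin
  obtain ⟨u, hu0, hu⟩ := exists_eigenvector hmin' hns
  have hbot : Va ≠ ⊥ := fun h => hv0 (by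
    have hv' : v ∈ Va := (hmemVa v).2 hv
    rw [h] at hv'
    exact (Submodule.mem_bot K).1 hv')
  have htop : Va ≠ ⊤ := by
    intro h
    have hu' : u ∈ Va := by rw [h]; exact Submodule.mem_top
    rw [hmemVa, sub_smul_one_mulVec_eq_zero_iff] at hu'
    have hub := (sub_smul_one_mulVec_eq_zero_iff S₀ b u).1 hu
    have : (a - b) • u = 0 := by rw [sub_smul, ← hu', ← hub, sub_self]
    exact hu0 ((smul_eq_zero.1 this).resolve_left hab')
  have h1 : 1 ≤ Module.finrank K Va := by
    rw [Nat.one_le_iff_ne_zero]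
    exact fun h => hbot (Submodule.finrank_eq_zero.1 h)
  have h2 : Module.finrank K Va < 3 := by
    have := Submodule.finrank_lt htop
    rwa [Module.finrank_fin_fun] at this
  refine ⟨Module.finrank K Va, by omega, ?_⟩
  have hcard : ((3 : ℕ) : K) = 3 := by norm_cast
  rw [hcard] at htr
  have := htr
  field_simp at this
  linear_combination this

/-- TRACE PARITY of a skew matrix: `σ (trace S₀) = −trace S₀`. [folklore] -/
private theorem sigma_trace_eq_neg {J S₀ : Matrix (Fin 3) (Fin 3) K} (hJ : IsUnit J.det) (hS : (S₀.map σ)ᵀ * J + J * S₀ = 0) :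
    σ S₀.trace = -S₀.trace := by
  have h1 : (S₀.map σ)ᵀ = -(J * S₀ * J⁻¹) := by
    have h2 : (S₀.map σ)ᵀ * J = -(J * S₀) := eq_neg_of_add_eq_zero_left hS
    calc (S₀.map σ)ᵀ = (S₀.map σ)ᵀ * J * J⁻¹ := (Matrix.mul_nonsing_inv_cancel_right J _ hJ).symm
      _ = -(J * S₀ * J⁻¹) := by rw [h2, Matrix.neg_mul]
  have h3 : σ S₀.trace = ((S₀.map σ)ᵀ).trace := by
    rw [Matrix.trace_transpose]
    simp [Matrix.trace, Matrix.diag, map_sum]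
  rw [h3, h1, Matrix.trace_neg, Matrix.mul_assoc, Matrix.trace_mul_comm, Matrix.nonsing_inv_mul_cancel_right J _ hJ]

/-- **`σ a = −a`** for a non-scalar skew `S₀` with `(S₀ − a)(S₀ − b) = 0`, `a ≠ b` (the alternative `σ a = −b`, `σ b = −a` would make
`σ (trace S₀) = −trace S₀` read `(a − b)(3 − 2 dim V_a) = 0`, impossible for `dim V_a ∈ {1,2}`). [folklore] -/
private theorem sigma_eq_neg (hσ : ∀ x, σ (σ x) = x) {J S₀ : Matrix (Fin 3) (Fin 3) K} (hJ : IsUnit J.det) (hS : (S₀.map σ)ᵀ * J + J * S₀ = 0)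
    {a b : K} (hab : a ≠ b) (hmin : (S₀ - a • 1) * (S₀ - b • 1) = 0) (hns : ∀ c : K, S₀ ≠ c • 1) : σ a = -a := by
  rcases sigma_eq_neg_or σ hJ hS hab hmin hns with h | h
  · exact h
  · exfalso
    have hσb : σ b = -a := by
      have := congrArg σ h
      rw [hσ, map_neg] at this
      rw [eq_neg_iff_add_eq_zero, add_comm, ← eq_neg_iff_add_eq_zero]
      exact this.symm ▸ (neg_neg (σ b)).symm ▸ rfl
    obtain ⟨r, hr, htr⟩ := trace_eq_of_typeAAB hab hmin hns
    have hσt := sigma_trace_eq_neg σ hJ hS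
    rw [htr, map_add, map_mul, map_mul, map_sub, map_natCast, map_ofNat, h, hσb] at hσt
    -- `(−b + a) r − 3a = −((a − b) r + 3 b)`, i.e. `(a − b)(2r − 3) = 0`
    have hab' : a - b ≠ 0 := sub_ne_zero.2 hab
    have key : ((2 : K) * r - 3) * (a - b) = 0 := by linear_combination hσt
    have h23 : (2 : K) * r - 3 = 0 := (mul_eq_zero.1 key).resolve_right hab'
    rcases hr with rfl | rfl
    · norm_num at h23
    · norm_num at h23

/-- **`σ a = −a ∧ σ b = −b`** (both eigenvalues of a non-regular semisimple skew `S₀` are `σ`-skew). [folklore] -/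
private theorem sigma_eq_neg_both (hσ : ∀ x, σ (σ x) = x) {J S₀ : Matrix (Fin 3) (Fin 3) K} (hJ : IsUnit J.det)
    (hS : (S₀.map σ)ᵀ * J + J * S₀ = 0) {a b : K} (hab : a ≠ b) (hmin : (S₀ - a • 1) * (S₀ - b • 1) = 0) (hns : ∀ c : K, S₀ ≠ c • 1) :
    σ a = -a ∧ σ b = -b := by
  have hmin' : (S₀ - b • 1) * (S₀ - a • 1) = 0 := by rw [factors_comm]; exact hmin
  exact ⟨sigma_eq_neg σ hσ hJ hS hab hmin hns, sigma_eq_neg σ hσ hJ hS hab.symm hmin' hns⟩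

/-! ### Dimensions: one of the two eigenspaces is a plane -/

/-- `dim V_a = 2` or `dim V_b = 2` (`V_a + V_b = K³`, each of dimension `≤ 2`). [folklore] -/
private theorem finrank_ker_eq_two_or {S₀ : Matrix (Fin 3) (Fin 3) K} {a b : K} (hab : a ≠ b) (hmin : (S₀ - a • 1) * (S₀ - b • 1) = 0)
    (hns : ∀ c : K, S₀ ≠ c • 1) :
    Module.finrank K (LinearMap.ker (Matrix.toLin' (S₀ - a • (1 : Matrix (Fin 3) (Fin 3) K)))) = 2 ∨
      Module.finrank K (LinearMap.ker (Matrix.toLin' (S₀ - b • (1 : Matrix (Fin 3) (Fin 3) K)))) = 2 := by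
  have hmin' : (S₀ - b • 1) * (S₀ - a • 1) = 0 := by rw [factors_comm]; exact hmin
  have hmem : ∀ (c : K) v, v ∈ LinearMap.ker (Matrix.toLin' (S₀ - c • (1 : Matrix (Fin 3) (Fin 3) K))) ↔
      (S₀ - c • (1 : Matrix (Fin 3) (Fin 3) K)) *ᵥ v = 0 := fun c v => by
    rw [LinearMap.mem_ker, Matrix.toLin'_apply]
  -- each eigenspace is a PROPER subspace: dimension `< 3`
  have hlt : ∀ {c c' : K}, c ≠ c' → (S₀ - c • 1) * (S₀ - c' • 1) = 0 → (S₀ - c' • 1) * (S₀ - c • 1) = 0 →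
      Module.finrank K (LinearMap.ker (Matrix.toLin' (S₀ - c • (1 : Matrix (Fin 3) (Fin 3) K)))) < 3 := by
    intro c c' hcc' h h'
    obtain ⟨u, hu0, hu⟩ := exists_eigenvector h' hns
    have htop : LinearMap.ker (Matrix.toLin' (S₀ - c • (1 : Matrix (Fin 3) (Fin 3) K))) ≠ ⊤ := by
      intro ht
      have hu' : u ∈ LinearMap.ker (Matrix.toLin' (S₀ - c • (1 : Matrix (Fin 3) (Fin 3) K))) := by rw [ht]; exact Submodule.mem_top
      rw [hmem, sub_smul_one_mulVec_eq_zero_iff] at hu'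
      have hub := (sub_smul_one_mulVec_eq_zero_iff S₀ c' u).1 hu
      have : (c - c') • u = 0 := by rw [sub_smul, ← hu', ← hub, sub_self]
      exact hu0 ((smul_eq_zero.1 this).resolve_left (sub_ne_zero.2 hcc'))
    have := Submodule.finrank_lt htop
    rwa [Module.finrank_fin_fun] at this
  have ha3 := hlt hab hmin hmin'
  have hb3 := hlt hab.symm hmin' hmin
  set Va : Submodule K (Fin 3 → K) := LinearMap.ker (Matrix.toLin' (S₀ - a • (1 : Matrix (Fin 3) (Fin 3) K))) with hVa
  set Vb : Submodule K (Fin 3 → K) := LinearMap.ker (Matrix.toLin' (S₀ - b • (1 : Matrix (Fin 3) (Fin 3) K))) with hVb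
  -- and together they span: `3 ≤ dim V_a + dim V_b`
  have hsup : Va ⊔ Vb = ⊤ := by
    refine Submodule.eq_top_iff'.2 fun v => ?_
    obtain ⟨hdec, hva, hvb⟩ := eigen_decomp hab hmin v
    rw [hdec]
    exact Submodule.add_mem_sup ((hmem a _).2 hva) ((hmem b _).2 hvb)
  have hsum : 3 ≤ Module.finrank K Va + Module.finrank K Vb := by
    have h := Submodule.finrank_add_le_finrank_add_finrank Va Vb
    rw [hsup, finrank_top, Module.finrank_fin_fun] at h
    exact h
  omega

/-! ### Gram–Schmidt in the planar eigenspace -/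

/-- In the `2`-dimensional eigenspace there is an `h`-ORTHOGONAL PAIR of non-isotropic eigenvectors (Gram–Schmidt from a non-isotropic `v₁`;
the second vector is non-isotropic because `h` is non-degenerate on the plane). [folklore] -/
private theorem exists_orthogonal_pair [Invertible (2 : K)] (hσ : ∀ x, σ (σ x) = x) {J S₀ : Matrix (Fin 3) (Fin 3) K} (hJσ : (J.map σ)ᵀ = J)
    (hJ : IsUnit J.det) (hS : (S₀.map σ)ᵀ * J + J * S₀ = 0) {a b : K} (hab : a ≠ b) (hmin : (S₀ - a • 1) * (S₀ - b • 1) = 0)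
    (hns : ∀ c : K, S₀ ≠ c • 1) (hσa : σ a = -a)
    (hr : Module.finrank K (LinearMap.ker (Matrix.toLin' (S₀ - a • (1 : Matrix (Fin 3) (Fin 3) K)))) = 2) :
    ∃ v₁ v₂ : Fin 3 → K, S₀ *ᵥ v₁ = a • v₁ ∧ S₀ *ᵥ v₂ = a • v₂ ∧ (σ ∘ v₁) ⬝ᵥ (J *ᵥ v₁) ≠ 0 ∧ (σ ∘ v₂) ⬝ᵥ (J *ᵥ v₂) ≠ 0 ∧
      (σ ∘ v₁) ⬝ᵥ (J *ᵥ v₂) = 0 := by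
  set W : Submodule K (Fin 3 → K) := LinearMap.ker (Matrix.toLin' (S₀ - a • (1 : Matrix (Fin 3) (Fin 3) K))) with hW
  have hmem : ∀ v, v ∈ W ↔ S₀ *ᵥ v = a • v := fun v => by
    rw [hW, LinearMap.mem_ker, Matrix.toLin'_apply, sub_smul_one_mulVec_eq_zero_iff]
  obtain ⟨v₁, hv₁, hn₁⟩ := exists_nonisotropic_eigenvector σ hσ hJσ hJ hS hab hmin hns hσa
  have hv₁0 : v₁ ≠ 0 := fun h => hn₁ (by rw [h]; simp)
  -- a second vector of `W` outside the line of `v₁`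
  obtain ⟨w, hwW, hw⟩ : ∃ w ∈ W, w ∉ K ∙ v₁ := by
    by_contra h
    push Not at h
    have hle : W ≤ K ∙ v₁ := fun x hx => h x hx
    have := Submodule.finrank_mono hle
    rw [hr, finrank_span_singleton hv₁0] at this
    omega
  have hwa : S₀ *ᵥ w = a • w := (hmem w).1 hwW
  -- Gram–Schmidt
  set c : K := ((σ ∘ v₁) ⬝ᵥ (J *ᵥ v₁))⁻¹ * ((σ ∘ v₁) ⬝ᵥ (J *ᵥ w)) with hc
  set v₂ : Fin 3 → K := w + (-c) • v₁ with hv₂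
  have hv₂a : S₀ *ᵥ v₂ = a • v₂ := by rw [hv₂, mulVec_add, mulVec_smul, hv₁, hwa, smul_add, smul_comm]
  have h12 : (σ ∘ v₁) ⬝ᵥ (J *ᵥ v₂) = 0 := by
    rw [hv₂, hform_add_right, hform_smul_right, hc, neg_mul, mul_comm ((σ ∘ v₁) ⬝ᵥ (J *ᵥ v₁))⁻¹, inv_mul_cancel_right₀ hn₁,
      add_neg_cancel]
  have h21 : (σ ∘ v₂) ⬝ᵥ (J *ᵥ v₁) = 0 := by rw [← hform_herm σ hσ hJσ, h12, map_zero]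
  have hv₂0 : v₂ ≠ 0 := by
    intro h0
    apply hw
    rw [Submodule.mem_span_singleton]
    exact ⟨c, by rw [hv₂, neg_smul, add_neg_eq_zero] at h0; exact h0.symm⟩
  refine ⟨v₁, v₂, hv₁, hv₂a, hn₁, ?_, h12⟩
  -- `v₂` is non-isotropic: otherwise `v₂ ⊥ span(v₁, v₂) = W` and `v₂ ⊥ V_b`, so `v₂` is in the radical
  intro hn₂
  apply hv₂0
  refine hform_nondeg_left σ hJ fun y => ?_
  obtain ⟨hdec, hya, hyb⟩ := eigen_decomp hab hmin y
  have hya' := (sub_smul_one_mulVec_eq_zero_iff S₀ a _).1 hya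
  have hyb' := (sub_smul_one_mulVec_eq_zero_iff S₀ b _).1 hyb
  rw [hdec, hform_add_right, hform_eq_zero_of_eigen σ hS hab hσa hv₂a hyb', add_zero]
  -- `y_a ∈ span {v₁, v₂} = W`
  have hli : LinearIndependent K ![v₁, v₂] := by
    rw [LinearIndependent.pair_iff' hv₁0]
    intro t ht
    have := congrArg (fun z => (σ ∘ v₁) ⬝ᵥ (J *ᵥ z)) ht
    simp only [hform_smul_right, h12] at this
    rcases mul_eq_zero.1 this with h0 | h0
    · rw [h0, zero_smul] at ht; exact hv₂0 ht.symm
    · exact hn₁ h0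
  have hspan : Submodule.span K (Set.range ![v₁, v₂]) = W := by
    refine Submodule.eq_of_le_of_finrank_eq ?_ ?_
    · rw [Submodule.span_le]
      rintro _ ⟨i, rfl⟩
      fin_cases i
      · exact (hmem _).2 hv₁
      · exact (hmem _).2 hv₂a
    · rw [finrank_span_eq_card hli, hr]; simp
  have hyaW : (a - b)⁻¹ • ((S₀ - b • 1) *ᵥ y) ∈ Submodule.span K (Set.range ![v₁, v₂]) := by rw [hspan]; exact (hmem _).2 hya'
  obtain ⟨cf, hcf⟩ := Submodule.mem_span_range_iff_exists_fun K |>.1 hyaW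
  rw [← hcf, Fin.sum_univ_two]
  simp only [Matrix.cons_val_zero, Matrix.cons_val_one]
  rw [hform_add_right, hform_smul_right, hform_smul_right, h21, hn₂, mul_zero, mul_zero, add_zero]

/-! ### The normal form -/

/-- **Normal form of a non-regular semisimple skew-hermitian `3 × 3` matrix.**  `σ` an involution of the field `K` (`2` invertible),
`J` hermitian (`(J^σ)ᵀ = J`) and invertible, `S₀` skew (`(S₀^σ)ᵀ J + J S₀ = 0`) with `(S₀ − a)(S₀ − b) = 0`, `a ≠ b`, and NOT SCALAR.
Then there is `g ∈ GL₃(K)` whose columns are an `h`-orthogonal eigenbasis: `g⁻¹ S₀ g = diag(a, a, b)` or `diag(a, b, b)` (according to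
the multiplicity of `a`; the second pattern is lettered `diag(b, b, a)` so that both read `diag(x, x, y)`), and `(g^σ)ᵀ J g = diag(d)` with every `d i` a NON-ZERO `σ`-FIXED scalar.  (Both eigenvalues are `σ`-skew, the two
eigenspaces are `h`-orthogonal and `h`-non-degenerate; Gram–Schmidt inside the planar one.)  ROAD «HC-D» brick (ii-B), re-cut per the
referee's R-758 (non-scalar hypothesis, multiplicity disjunction).
[cite: Scharlau1985HermitianForms, Ch. 7 (hermitian spaces over a field with involution: orthogonal bases)]
[cite: HornJohnson2013, §2.5 Thm. 2.5.3 (skew-Hermitian matrices are unitarily diagonalisable)] -/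
theorem exists_gl_conj_eq_diagonal_and_congr_diagonal [Invertible (2 : K)] (hσ : ∀ x, σ (σ x) = x) {J : Matrix (Fin 3) (Fin 3) K}
    (hJσ : (J.map σ)ᵀ = J) (hJ : IsUnit J.det) {S₀ : Matrix (Fin 3) (Fin 3) K} (hS : (S₀.map σ)ᵀ * J + J * S₀ = 0) {a b : K} (hab : a ≠ b)
    (hmin : (S₀ - a • 1) * (S₀ - b • 1) = 0) (hns : ∀ c : K, S₀ ≠ c • 1) :
    ∃ g : GL (Fin 3) K, (((g⁻¹ : GL (Fin 3) K) : Matrix (Fin 3) (Fin 3) K) * S₀ * g = diagonal ![a, a, b] ∨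
        ((g⁻¹ : GL (Fin 3) K) : Matrix (Fin 3) (Fin 3) K) * S₀ * g = diagonal ![b, b, a]) ∧
      ∃ d : Fin 3 → K, (∀ i, σ (d i) = d i ∧ d i ≠ 0) ∧ ((g : Matrix (Fin 3) (Fin 3) K).map σ)ᵀ * J * g = diagonal d := by
  have hmin' : (S₀ - b • 1) * (S₀ - a • 1) = 0 := by rw [factors_comm]; exact hmin
  obtain ⟨hσa, hσb⟩ := sigma_eq_neg_both σ hσ hJ hS hab hmin hns
  -- `h(v, v)` is `σ`-fixed
  have hfix : ∀ v : Fin 3 → K, σ ((σ ∘ v) ⬝ᵥ (J *ᵥ v)) = (σ ∘ v) ⬝ᵥ (J *ᵥ v) := fun v => hform_herm σ hσ hJσ v v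
  rcases finrank_ker_eq_two_or hab hmin hns with hr | hr
  · -- multiplicity pattern `(a, a, b)`
    obtain ⟨v₁, v₂, hv₁, hv₂, hn₁, hn₂, h12⟩ := exists_orthogonal_pair σ hσ hJσ hJ hS hab hmin hns hσa hr
    obtain ⟨u, hu, hnu⟩ := exists_nonisotropic_eigenvector σ hσ hJσ hJ hS hab.symm hmin' hns hσb
    have h21 : (σ ∘ v₂) ⬝ᵥ (J *ᵥ v₁) = 0 := by rw [← hform_herm σ hσ hJσ, h12, map_zero]
    have h1u := hform_eq_zero_of_eigen σ hS hab hσa hv₁ hu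
    have h2u := hform_eq_zero_of_eigen σ hS hab hσa hv₂ hu
    have hu1 := hform_eq_zero_of_eigen σ hS hab.symm hσb hu hv₁
    have hu2 := hform_eq_zero_of_eigen σ hS hab.symm hσb hu hv₂
    obtain ⟨g, hg1, hg2⟩ := exists_gl_of_orthogonal_eigenvectors σ (J := J) (S := S₀) ![v₁, v₂, u] ![a, a, b]
      (fun j => by fin_cases j <;> simp [hv₁, hv₂, hu])
      (fun i j hij => by
        fin_cases i <;> fin_cases j <;> first | exact absurd rfl hij | simp [h12, h21, h1u, h2u, hu1, hu2])
      (fun i => by fin_cases i <;> simp [hn₁, hn₂, hnu])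
    refine ⟨g, Or.inl (by rw [Matrix.coe_units_inv]; exact hg1), _, fun i => ⟨?_, ?_⟩, hg2⟩
    · fin_cases i <;> simp [hfix]
    · fin_cases i <;> simp [hn₁, hn₂, hnu]
  · -- multiplicity pattern `(b, b, a)`: the plane is `V_b`
    obtain ⟨v₁, v₂, hv₁, hv₂, hn₁, hn₂, h12⟩ := exists_orthogonal_pair σ hσ hJσ hJ hS hab.symm hmin' hns hσb hr
    obtain ⟨u, hu, hnu⟩ := exists_nonisotropic_eigenvector σ hσ hJσ hJ hS hab hmin hns hσa
    have h21 : (σ ∘ v₂) ⬝ᵥ (J *ᵥ v₁) = 0 := by rw [← hform_herm σ hσ hJσ, h12, map_zero]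
    have h1u := hform_eq_zero_of_eigen σ hS hab.symm hσb hv₁ hu
    have h2u := hform_eq_zero_of_eigen σ hS hab.symm hσb hv₂ hu
    have hu1 := hform_eq_zero_of_eigen σ hS hab hσa hu hv₁
    have hu2 := hform_eq_zero_of_eigen σ hS hab hσa hu hv₂
    obtain ⟨g, hg1, hg2⟩ := exists_gl_of_orthogonal_eigenvectors σ (J := J) (S := S₀) ![v₁, v₂, u] ![b, b, a]
      (fun j => by fin_cases j <;> simp [hv₁, hv₂, hu])
      (fun i j hij => by
        fin_cases i <;> fin_cases j <;> first | exact absurd rfl hij | simp [h12, h21, h1u, h2u, hu1, hu2])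
      (fun i => by fin_cases i <;> simp [hn₁, hn₂, hnu])
    refine ⟨g, Or.inr (by rw [Matrix.coe_units_inv]; exact hg1), _, fun i => ⟨?_, ?_⟩, hg2⟩
    · fin_cases i <;> simp [hfix]
    · fin_cases i <;> simp [hn₁, hn₂, hnu]

/-- **Matrix spelling** of `exists_gl_conj_eq_diagonal_and_congr_diagonal` (`g : Matrix (Fin 3) (Fin 3) K` with `IsUnit g.det`, the letters of the
(ii-T) transport `…SliceConjTransport`). [cite: Scharlau1985HermitianForms, Ch. 7 (hermitian spaces over a field with involution: orthogonal bases)] -/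
theorem exists_isUnit_conj_eq_diagonal_and_congr_diagonal [Invertible (2 : K)] (hσ : ∀ x, σ (σ x) = x) {J : Matrix (Fin 3) (Fin 3) K}
    (hJσ : (J.map σ)ᵀ = J) (hJ : IsUnit J.det) {S₀ : Matrix (Fin 3) (Fin 3) K} (hS : (S₀.map σ)ᵀ * J + J * S₀ = 0) {a b : K} (hab : a ≠ b)
    (hmin : (S₀ - a • 1) * (S₀ - b • 1) = 0) (hns : ∀ c : K, S₀ ≠ c • 1) :
    ∃ g : Matrix (Fin 3) (Fin 3) K, IsUnit g.det ∧ (g⁻¹ * S₀ * g = diagonal ![a, a, b] ∨ g⁻¹ * S₀ * g = diagonal ![b, b, a]) ∧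
      ∃ d : Fin 3 → K, (∀ i, σ (d i) = d i ∧ d i ≠ 0) ∧ (g.map σ)ᵀ * J * g = diagonal d := by
  obtain ⟨g, hg, d, hd, hgJ⟩ := exists_gl_conj_eq_diagonal_and_congr_diagonal σ hσ hJσ hJ hS hab hmin hns
  refine ⟨g, Matrix.isUnits_det_units g, ?_, d, hd, hgJ⟩
  rw [Matrix.coe_units_inv] at hg
  exact hg

/-- **The eigenvalues are `σ`-skew**: under the hypotheses of `exists_gl_conj_eq_diagonal_and_congr_diagonal`, `σ a = −a` and `σ b = −b`
(exported for the consumers' bookkeeping). [cite: HornJohnson2013, §2.5 Thm. 2.5.3 (eigenvalues of a skew-Hermitian matrix are skew)] -/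
theorem sigma_eigenvalue_eq_neg [Invertible (2 : K)] (hσ : ∀ x, σ (σ x) = x) {J : Matrix (Fin 3) (Fin 3) K} (hJ : IsUnit J.det)
    {S₀ : Matrix (Fin 3) (Fin 3) K} (hS : (S₀.map σ)ᵀ * J + J * S₀ = 0) {a b : K} (hab : a ≠ b) (hmin : (S₀ - a • 1) * (S₀ - b • 1) = 0)
    (hns : ∀ c : K, S₀ ≠ c • 1) : σ a = -a ∧ σ b = -b :=
  sigma_eq_neg_both σ hσ hJ hS hab hmin hns

end SkewHermitian

end Literature.LinearAlgebra.Matrix
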